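import Literature.NumberTheory.Automorphic.SatakeParametersGLProofs
import Literature.NumberTheory.Automorphic.HeckeGelfandPair
import HarnessLib

/-!
# `(GL_n(F), GL_n(𝒪_F))` is a Gelfand pair — the proof

Topic `NumberTheory/Automorphic`.  A *proofs* file (theorems only): it DISCHARGES the named fact
`Literature.NumberTheory.Automorphic.SatakeParametersGL.isGelfandPair_glInt` of module
`SatakeParametersGL` (D-0014),

* `SatakeParametersGL.isGelfandPair_glInt_holds : SatakeParametersGL.isGelfandPair_glInt n F`,

i.e. the commutativity of the Hecke algebra `ℋ(GL_n(F), GL_n(𝒪_F)) = End_G(ℂ[G ⧸ K₀])`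
(`heckeAlgebra`, `IsGelfandPair` of module `HeckeAlgebra`) for a non-archimedean local field `F`
(Mathlib's `IsNonarchimedeanLocalField`; `K₀ = glInt n F = GL_n(𝒪_F)` of `ReductiveGroupData`).

## The proof (Gelfand's trick with the transpose)

Bump, *Automorphic Forms and Representations* (1997), Thm. 4.6.1 ("the identical argument works
for `GL(n)` without modification") and proof of Thm. 3.3.3; Getz–Hahn, *An Introduction to
Automorphic Representations* (2024), Thm. 5.5.1 with Exercise 5.14; Cartier, *Representations of
𝔭-adic groups: a survey*, Corvallis 1979, §IV.1 (the citation carried by the fact):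

1. the transpose `t` (`glTranspose` of `CartanDecompositionGLn`, an anti-involution
   `GL_n(F) ≃* GL_n(F)ᵐᵒᵖ`, `glTranspose_glTranspose`) preserves `K₀`
   (`glTranspose_mem_glInt` of `SatakeParametersGLProofs`);
2. **Cartan decomposition**: every double coset `K₀ x K₀` contains a diagonal matrix (Smith
   normal form over the discrete valuation ring `𝒪_F`), hence `ᵗx ∈ K₀ x K₀`
   (`exists_glTranspose_eq_glInt_mul_mul` of `SatakeParametersGLProofs`);
3. Gelfand's trick for the model `End_G(k[G ⧸ K])` of the Hecke algebra
   (`IsGelfandPair.of_antiInvolution` of `HeckeGelfandPair`): the matrix coefficients of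
   `T ∈ ℋ(G, K₀)` in the coset basis form a bi-`K₀`-invariant, hence `t`-invariant, kernel, and
   reindexing along `g ↦ ᵗg⁻¹` exchanges the two orders of composition.

The companion statement for the concrete Hecke operators `[K₀xK₀]` on `V^{K₀}`
(`heckeOperator_glInt_comm_apply`) is in `SatakeParametersGLProofs`; nothing else is here.

## References

* D. Bump, *Automorphic Forms and Representations* (1997), Thm. 4.6.1, proof of Thm. 3.3.3
  [Bump1997].
* J. R. Getz, H. Hahn, *An Introduction to Automorphic Representations* (2024), Thm. 5.5.1,
  Exercise 5.14 [GetzHahn2024].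
* P. Cartier, *Representations of 𝔭-adic groups: a survey*, Proc. Sympos. Pure Math. 33 (1979),
  part 1, §IV.1 [CartierCorvallis1979].
-/

universe u

open scoped MatrixGroups

namespace Literature.NumberTheory.Automorphic

section GLn

variable (n : ℕ) (F : Type u) [Field F] [ValuativeRel F] [TopologicalSpace F]
  [IsNonarchimedeanLocalField F]

/-- **`(GL_n(F), GL_n(𝒪_F))` is a Gelfand pair** (discharge of the named fact
`SatakeParametersGL.isGelfandPair_glInt`): the Hecke algebra
`ℋ(GL_n(F), GL_n(𝒪_F)) = End_G(ℂ[G ⧸ K₀])` is commutative, by Gelfand's trick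
(`IsGelfandPair.of_antiInvolution` of `HeckeGelfandPair`) applied to the transpose, an
anti-involution of `GL_n(F)` preserving `K₀ = GL_n(𝒪_F)` (`glTranspose_mem_glInt`) and fixing
every double coset `K₀ x K₀`, each of which contains a diagonal matrix by the Cartan decomposition
(`exists_glTranspose_eq_glInt_mul_mul`).  Bump, *Automorphic Forms and Representations* (1997),
Thm. 4.6.1 ("the identical argument works for `GL(n)` without modification") and proof of
Thm. 3.3.3; Getz–Hahn (2024), Thm. 5.5.1 and Exercise 5.14; Cartier, Corvallis 1979, §IV.1.
[cite: Bump1997, Thm. 4.6.1] -/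
theorem SatakeParametersGL.isGelfandPair_glInt_holds :
    SatakeParametersGL.isGelfandPair_glInt n F :=
  IsGelfandPair.of_antiInvolution (glTranspose (Fin n)) (fun _ hκ => glTranspose_mem_glInt hκ)
    glTranspose_glTranspose exists_glTranspose_eq_glInt_mul_mul

end GLn

end Literature.NumberTheory.Automorphic
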